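import Summits.BirchSwinnertonDyer.BirchSwinnertonDyer.Theorems.ClassRecordThreeRegCertKernelLog
import HarnessLib

/-!
# Route `ClassRecordThree`, crux `SchneiderAtThree` (item 19106): a GENERIC first-order kernel evaluator for the
# Stein–Wuthrich §4.2 height, part 2 — `ch(w) − 1`, `σ²`, the two Iwasawa logarithms, and
# `heightFourOneCoord W 3 q x y ≠ 0` from an integer RESIDUE CERTIFICATE
# (cell `bsd-stepL`, seat `bsd-stepL-reg3-eng` g3; `--supports stmt-BirchSwinnertonDyer-19106`)

HONEST FRAMING: BSD is not proved by any of this; nothing here closes the crux; Schneider's non-degeneracy conjecture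
(barrier `PAdicHeightNondegeneracy`) is asserted NOWHERE. Continuation of `…RegCertKernelLog` (part 1: `C² ≡ γ`,
`z ≡ ζ`, `log_Ŵ(z) ≡ ℓ`, `w ≡ ω`). Here, still for arbitrary `W/ℚ` (globally minimal) and arbitrary `‖q‖₃ < 1`:

* §4 `norm_coshOfSq_sub_one_sub_intCast_le`: `‖(ch(w) − 1) − κ‖ ≤ 3⁻⁴` from `‖w − ω‖ ≤ 3⁻⁴`, `9 ∣ ω`,
  `3⁵ ∣ ω² + 12ω − 24κ` (the `cosh` series to second order, `norm_coshOfSq_sub_le`, p425825);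
* §5 `norm_tateSigmaSq_sub_intCast_le`: `‖σ² − 2κ‖ ≤ 3⁻⁴` (`σ² = 2(c − 1)·Π`, `‖Π − 1‖ ≤ ‖q‖‖c − 1‖`, p425825);
* §6 `norm_padicLog_sub_le_of_norm_sub_le`: `‖Y − 9u‖ ≤ 3⁻⁴`, `3 ∤ u` ⇒ `‖log₃ Y − (u² − 1)/2‖ ≤ 3⁻²` (Iwasawa
  logarithm to first order, tree `padicLog_of_ne_zero` + `norm_padicLogSeries_add_le`); applied to `Y = C²σ²`
  (`9u = 2γκ`) and to `Y = den x(Q) = 9e'²` (`u = e'²`);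
* §7 **`heightFourOneCoord_ne_zero_of_residueCert`**: `h = log₃(den x) − log₃(C²σ²) ≡ (e'⁴ − u²)/2 (mod 9)`, so the
  single decidable condition **`9 ∤ e'⁴ − u²`** gives `heightFourOneCoord W 3 q x y ≠ 0` for EVERY `‖q‖₃ < 1` — the
  numerical content `HH` of a REG3CERT row with `(v₃(e), v₃(h)) = (1, 1)`, from six small integers and nine integer
  divisibilities. The row `62310y1@3` of the g2 witness is the instance `(γ, ζ, ℓ, ω, κ, u) = (8, 21, 3, 72, 9, 16)`.

Theorems only (0 defs, 0 facts). References: [SteinWuthrich2013] §4.2; [Iwasawa1972PadicL] §4.4; [SilvermanATAEC1994] V.3.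
-/

open scoped Classical

open WeierstrassCurve Literature.NumberTheory.EllipticCurves
  Literature.NumberTheory.EllipticCurves.SteinWuthrich2013
  Summit.BirchSwinnertonDyer.Rank1Residual.X11b.RegMult.Rung62310y1

namespace Summit.BirchSwinnertonDyer.Rank1Residual.X11b.RegMult.KernelCert

/-! ### §0 Plumbing -/

/-- Ultrametric inequality for differences. [folklore] -/
private theorem norm_sub_le_max₁ (a b : ℚ_[3]) : ‖a - b‖ ≤ max ‖a‖ ‖b‖ := by
  rw [sub_eq_add_neg, ← norm_neg b]; exact IsUltrametricDist.norm_add_le_max a (-b)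

/-- `‖(2 : ℚ₃)⁻¹‖ = 1`. [folklore] -/
private theorem norm_inv_two' : ‖(2 : ℚ_[3])⁻¹‖ = 1 := by
  rw [norm_inv, show (2 : ℚ_[3]) = ((2 : ℤ) : ℚ_[3]) by norm_cast, norm_intCast_eq_one_of_not_dvd (by decide),
    inv_one]

/-- `‖(24 : ℚ₃)⁻¹‖ = 3`. [folklore] -/
private theorem norm_inv_twentyfour' : ‖(24 : ℚ_[3])⁻¹‖ = 3 := by
  have h8 : ‖(8 : ℚ_[3])⁻¹‖ = 1 := by
    rw [norm_inv, show (8 : ℚ_[3]) = ((8 : ℤ) : ℚ_[3]) by norm_cast, norm_intCast_eq_one_of_not_dvd (by decide),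
      inv_one]
  have h3 : ‖(3 : ℚ_[3])⁻¹‖ = 3 := by
    rw [norm_inv, show (3 : ℚ_[3]) = ((3 : ℕ) : ℚ_[3]) by norm_cast, Padic.norm_p]; norm_num
  rw [show (24 : ℚ_[3]) = 8 * 3 by norm_num, mul_inv, norm_mul, h8, h3, one_mul]

/-- `3 ∤ u ⇒ 3 ∣ u² − 1`. [folklore] -/
private theorem three_dvd_sq_sub_one {u : ℤ} (h : ¬ (3 : ℤ) ∣ u) : (3 : ℤ) ∣ u ^ 2 - 1 := by
  have key : ∀ x : ZMod 3, x ≠ 0 → x ^ 2 - 1 = 0 := by decide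
  have hx : ((u : ZMod 3)) ≠ 0 := by
    rw [Ne, ZMod.intCast_zmod_eq_zero_iff_dvd]; exact_mod_cast h
  have h1 := key _ hx
  have h2 : (((u ^ 2 - 1 : ℤ)) : ZMod 3) = 0 := by push_cast; exact h1
  exact_mod_cast (ZMod.intCast_zmod_eq_zero_iff_dvd _ 3).mp h2

/-! ### §4 `ch(w) − 1 ≡ κ (mod 3⁴)` -/

/-- **`ch(w) − 1 ≡ κ (mod 3⁴)`**: from `‖w − ω‖₃ ≤ 3⁻⁴`, `9 ∣ ω`, `3⁵ ∣ ω² + 12ω − 24κ`: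
`‖(coshOfSq w − 1) − κ‖₃ ≤ 3⁻⁴` (`ch(w) = 1 + w/2 + w²/24 + O(3⁻⁴)` on `‖w‖ ≤ 3⁻²`, `norm_coshOfSq_sub_le`;
`(w/2 + w²/24) − (ω/2 + ω²/24) = (w − ω)(1/2 + (w + ω)/24)`; `ω/2 + ω²/24 − κ = (ω² + 12ω − 24κ)/24`). [folklore] -/
theorem norm_coshOfSq_sub_one_sub_intCast_le {w : ℚ_[3]} {ω κ : ℤ} (hw : ‖w - ω‖ ≤ 1 / 81) (hω9 : (9 : ℤ) ∣ ω)
    (hκ : (243 : ℤ) ∣ ω ^ 2 + 12 * ω - 24 * κ) : ‖(coshOfSq w - 1) - κ‖ ≤ 1 / 81 := by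
  have hωn : ‖(ω : ℚ_[3])‖ ≤ 1 / 9 := (norm_intCast_le_of_pow_dvd (k := 2) (by norm_num; exact hω9)).trans (by norm_num)
  have hwn : ‖w‖ ≤ 1 / 9 := by
    have : w = (w - ω) + ω := by ring
    rw [this]; exact (IsUltrametricDist.norm_add_le_max _ _).trans (max_le (hw.trans (by norm_num)) hωn)
  have hcosh := norm_coshOfSq_sub_le hwn
  have hsplit : (coshOfSq w - 1) - κ = (coshOfSq w - (1 + w / 2 + w ^ 2 / 24)) +
      (w - ω) * ((2 : ℚ_[3])⁻¹ + (24 : ℚ_[3])⁻¹ * (w + ω)) +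
      (24 : ℚ_[3])⁻¹ * (((ω ^ 2 + 12 * ω - 24 * κ : ℤ) : ℚ_[3])) := by
    have h2 : (2 : ℚ_[3]) ≠ 0 := by norm_num
    have h24 : (24 : ℚ_[3]) ≠ 0 := by norm_num
    push_cast; field_simp; ring
  rw [hsplit]
  refine (IsUltrametricDist.norm_add_le_max _ _).trans (max_le ?_ ?_)
  · refine (IsUltrametricDist.norm_add_le_max _ _).trans (max_le hcosh ?_)
    rw [norm_mul]
    have hbr : ‖(2 : ℚ_[3])⁻¹ + (24 : ℚ_[3])⁻¹ * (w + ω)‖ ≤ 1 := by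
      refine (IsUltrametricDist.norm_add_le_max _ _).trans (max_le (by rw [norm_inv_two']) ?_)
      rw [norm_mul, norm_inv_twentyfour']
      calc 3 * ‖w + ω‖ ≤ 3 * (1 / 9) := by
            gcongr; exact (IsUltrametricDist.norm_add_le_max _ _).trans (max_le hwn hωn)
        _ ≤ 1 := by norm_num
    calc ‖w - ω‖ * ‖(2 : ℚ_[3])⁻¹ + (24 : ℚ_[3])⁻¹ * (w + ω)‖ ≤ 1 / 81 * 1 := by gcongr
      _ = 1 / 81 := mul_one _
  · rw [norm_mul, norm_inv_twentyfour']
    calc 3 * ‖(((ω ^ 2 + 12 * ω - 24 * κ : ℤ) : ℚ_[3]))‖ ≤ 3 * (1 / 243) := by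
          gcongr; exact (norm_intCast_le_of_pow_dvd (k := 5) (by norm_num; exact hκ)).trans (by norm_num)
      _ = 1 / 81 := by norm_num

/-! ### §5 `σ² ≡ 2κ (mod 3⁴)` -/

/-- **`σ² ≡ 2κ (mod 3⁴)`**: for `‖q‖₃ ≤ 3⁻¹`, `‖(c − 1) − κ‖₃ ≤ 3⁻⁴`, `9 ∣ κ`: `‖tateSigmaSq q c − 2κ‖₃ ≤ 3⁻⁴`
(`σ² = 2(c − 1)·Π` with `‖Π − 1‖ ≤ ‖q‖·‖c − 1‖ ≤ 3⁻³`, `norm_tprod_tateSigmaSq_factor_sub_one_le`).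
[cite: SteinWuthrich2013, §4.2] -/
theorem norm_tateSigmaSq_sub_intCast_le {q c : ℚ_[3]} {κ : ℤ} (hq : ‖q‖ ≤ 1 / 3) (hcκ : ‖(c - 1) - κ‖ ≤ 1 / 81)
    (hκ9 : (9 : ℤ) ∣ κ) : ‖tateSigmaSq q c - 2 * κ‖ ≤ 1 / 81 := by
  have hq1 : ‖q‖ < 1 := hq.trans_lt (by norm_num)
  have hκn : ‖(κ : ℚ_[3])‖ ≤ 1 / 9 := (norm_intCast_le_of_pow_dvd (k := 2) (by norm_num; exact hκ9)).trans (by norm_num)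
  have hc1 : ‖c - 1‖ ≤ 1 / 9 := by
    have : c - 1 = ((c - 1) - κ) + κ := by ring
    rw [this]; exact (IsUltrametricDist.norm_add_le_max _ _).trans (max_le (hcκ.trans (by norm_num)) hκn)
  have hc : ‖c‖ ≤ 1 := by
    have : c = (c - 1) + 1 := by ring
    rw [this]; exact (IsUltrametricDist.norm_add_le_max _ _).trans (max_le (hc1.trans (by norm_num)) (by rw [norm_one]))
  have hP := norm_tprod_tateSigmaSq_factor_sub_one_le hq1 hc
  set P := ∏' n : ℕ, (1 - 2 * q ^ (n + 1) * c + q ^ (2 * (n + 1))) ^ 2 / (1 - q ^ (n + 1)) ^ 4 with hPdef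
  have hdef : tateSigmaSq q c = 2 * (c - 1) * P := by rw [tateSigmaSq]
  rw [hdef]
  have hsplit : 2 * (c - 1) * P - 2 * κ = 2 * (c - 1) * (P - 1) + 2 * ((c - 1) - κ) := by ring
  rw [hsplit]
  have h2 : ‖(2 : ℚ_[3])‖ ≤ 1 := by
    rw [show (2 : ℚ_[3]) = ((2 : ℤ) : ℚ_[3]) by norm_cast]; exact Padic.norm_int_le_one _
  refine (IsUltrametricDist.norm_add_le_max _ _).trans (max_le ?_ ?_)
  · rw [norm_mul, norm_mul]
    calc ‖(2 : ℚ_[3])‖ * ‖c - 1‖ * ‖P - 1‖ ≤ 1 * (1 / 9) * (‖q‖ * ‖c - 1‖) := by gcongr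
      _ ≤ 1 * (1 / 9) * (1 / 3 * (1 / 9)) := by gcongr
      _ ≤ 1 / 81 := by norm_num
  · rw [norm_mul]
    calc ‖(2 : ℚ_[3])‖ * ‖(c - 1) - κ‖ ≤ 1 * (1 / 81) := by gcongr
      _ = 1 / 81 := one_mul _

/-- **`C²σ² ≡ 9u (mod 3⁴)`** from `‖C² − γ‖ ≤ 3⁻²` (`3 ∤ γ`), `‖σ² − 2κ‖ ≤ 3⁻⁴` (`9 ∣ κ`) and `9u = 2γκ`. [folklore] -/
theorem norm_mul_sub_nine_mul_le {C2 S2 : ℚ_[3]} {γ κ u : ℤ} (hC : ‖C2 - γ‖ ≤ 1 / 9) (h3γ : ¬ (3 : ℤ) ∣ γ)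
    (hS : ‖S2 - 2 * κ‖ ≤ 1 / 81) (hκ9 : (9 : ℤ) ∣ κ) (hu : 9 * u = 2 * γ * κ) :
    ‖C2 * S2 - 9 * u‖ ≤ 1 / 81 := by
  have hγn : ‖(γ : ℚ_[3])‖ = 1 := norm_intCast_eq_one_of_not_dvd h3γ
  have hCn : ‖C2‖ = 1 := by
    rw [← hγn]; exact Padic.norm_eq_of_norm_sub_lt_right (hC.trans_lt (by rw [hγn]; norm_num))
  have hκn : ‖(κ : ℚ_[3])‖ ≤ 1 / 9 := (norm_intCast_le_of_pow_dvd (k := 2) (by norm_num; exact hκ9)).trans (by norm_num)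
  have h9u : (9 : ℚ_[3]) * u = 2 * γ * κ := by exact_mod_cast hu
  have hsplit : C2 * S2 - 9 * u = C2 * (S2 - 2 * κ) + (C2 - γ) * (2 * κ) := by rw [h9u]; ring
  rw [hsplit]
  have h2 : ‖(2 : ℚ_[3])‖ ≤ 1 := by
    rw [show (2 : ℚ_[3]) = ((2 : ℤ) : ℚ_[3]) by norm_cast]; exact Padic.norm_int_le_one _
  refine (IsUltrametricDist.norm_add_le_max _ _).trans (max_le ?_ ?_)
  · rw [norm_mul, hCn, one_mul]; exact hS
  · rw [norm_mul, norm_mul]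
    calc ‖C2 - γ‖ * (‖(2 : ℚ_[3])‖ * ‖(κ : ℚ_[3])‖) ≤ 1 / 9 * (1 * (1 / 9)) := by gcongr
      _ = 1 / 81 := by norm_num

/-! ### §6 The Iwasawa logarithm at valuation `2` to first order -/

/-- **`‖Y − 9u‖₃ ≤ 3⁻⁴`, `3 ∤ u ⇒ ‖log₃ Y − (u² − 1)/2‖₃ ≤ 3⁻²`.** Here `log₃ Y = 2⁻¹·L((Y·3⁻²)²)` (tree
`padicLog_of_ne_zero`, `ord₃ Y = 2`), `t := Y·3⁻²` has `‖t − u‖ ≤ 3⁻²`, `‖1 − t²‖ ≤ 3⁻¹`, and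
`‖L(t²) − (t² − 1)‖ ≤ ‖1 − t²‖²` (`norm_padicLogSeries_add_le`). [cite: Iwasawa1972PadicL, §4.4] -/
theorem norm_padicLog_sub_le_of_norm_sub_le {Y : ℚ_[3]} {u : ℤ} (h3u : ¬ (3 : ℤ) ∣ u) (hY : ‖Y - 9 * u‖ ≤ 1 / 81) :
    ‖padicLog 3 Y - (2 : ℚ_[3])⁻¹ * (((u ^ 2 - 1 : ℤ)) : ℚ_[3])‖ ≤ 1 / 9 := by
  have hun : ‖(u : ℚ_[3])‖ = 1 := norm_intCast_eq_one_of_not_dvd h3u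
  have h9 : ‖(9 : ℚ_[3])‖ = 1 / 9 := by
    rw [show (9 : ℚ_[3]) = (3 : ℚ_[3]) ^ (2 : ℤ) by norm_num, show (3 : ℚ_[3]) = ((3 : ℕ) : ℚ_[3]) by norm_cast,
      Padic.norm_p_zpow]; norm_num
  have h9u : ‖(9 : ℚ_[3]) * u‖ = 1 / 9 := by rw [norm_mul, h9, hun, mul_one]
  have hYn : ‖Y‖ = 1 / 9 := by
    rw [← h9u]; exact Padic.norm_eq_of_norm_sub_lt_right (hY.trans_lt (by rw [h9u]; norm_num))
  have hY0 : Y ≠ 0 := by intro h; rw [h, norm_zero] at hYn; norm_num at hYn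
  have hv : Y.valuation = 2 := valuation_eq_of_norm_eq hY0 (n := 2) (by rw [hYn]; norm_num)
  have hlog : padicLog 3 Y = (2 : ℚ_[3])⁻¹ * padicLogSeries 3 ((Y * (3 : ℚ_[3]) ^ (-(2 : ℤ))) ^ 2) := by
    rw [padicLog_of_ne_zero hY0, hv]; norm_num
  rw [hlog]
  set t : ℚ_[3] := Y * (3 : ℚ_[3]) ^ (-(2 : ℤ)) with ht
  have htu : t - u = (Y - 9 * u) * (3 : ℚ_[3]) ^ (-(2 : ℤ)) := by
    rw [ht, zpow_neg, zpow_two]; field_simp; ring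
  have h3m2 : ‖(3 : ℚ_[3]) ^ (-(2 : ℤ))‖ = 9 := by
    rw [show (3 : ℚ_[3]) = ((3 : ℕ) : ℚ_[3]) by norm_cast, Padic.norm_p_zpow]; norm_num
  have htun : ‖t - u‖ ≤ 1 / 9 := by
    rw [htu, norm_mul, h3m2]
    calc ‖Y - 9 * u‖ * 9 ≤ 1 / 81 * 9 := by gcongr
      _ = 1 / 9 := by norm_num
  have htu1 : ‖t + u‖ ≤ 1 := by
    have : t + u = (t - u) + 2 * u := by ring
    rw [this]
    refine (IsUltrametricDist.norm_add_le_max _ _).trans (max_le (htun.trans (by norm_num)) ?_)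
    rw [show (2 : ℚ_[3]) * u = ((2 * u : ℤ) : ℚ_[3]) by push_cast; ring]; exact Padic.norm_int_le_one _
  have ht2 : ‖t ^ 2 - (u : ℚ_[3]) ^ 2‖ ≤ 1 / 9 := by
    have : t ^ 2 - (u : ℚ_[3]) ^ 2 = (t - u) * (t + u) := by ring
    rw [this, norm_mul]
    calc ‖t - u‖ * ‖t + u‖ ≤ 1 / 9 * 1 := by gcongr
      _ = 1 / 9 := mul_one _
  have hu21 : ‖(u : ℚ_[3]) ^ 2 - 1‖ ≤ 1 / 3 := by
    rw [show (u : ℚ_[3]) ^ 2 - 1 = ((u ^ 2 - 1 : ℤ) : ℚ_[3]) by push_cast; ring]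
    exact (norm_intCast_le_of_pow_dvd (k := 1) (by rw [pow_one]; exact three_dvd_sq_sub_one h3u)).trans
      (by norm_num)
  have h1t : ‖1 - t ^ 2‖ ≤ 1 / 3 := by
    have : 1 - t ^ 2 = -(t ^ 2 - (u : ℚ_[3]) ^ 2) + -((u : ℚ_[3]) ^ 2 - 1) := by ring
    rw [this]
    refine (IsUltrametricDist.norm_add_le_max _ _).trans (max_le ?_ ?_)
    · rw [norm_neg]; exact ht2.trans (by norm_num)
    · rw [norm_neg]; exact hu21
  have h1t' : ‖1 - t ^ 2‖ < 1 := h1t.trans_lt (by norm_num)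
  have hL := norm_padicLogSeries_add_le (p := 3) h1t'
  rw [norm_inv_two', mul_one] at hL
  have hsplit : (2 : ℚ_[3])⁻¹ * padicLogSeries 3 (t ^ 2) - (2 : ℚ_[3])⁻¹ * (((u ^ 2 - 1 : ℤ)) : ℚ_[3]) =
      (2 : ℚ_[3])⁻¹ * ((padicLogSeries 3 (t ^ 2) + (1 - t ^ 2)) + (t ^ 2 - (u : ℚ_[3]) ^ 2)) := by
    push_cast; ring
  rw [hsplit, norm_mul, norm_inv_two', one_mul]
  refine (IsUltrametricDist.norm_add_le_max _ _).trans (max_le ?_ ht2)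
  refine hL.trans ?_
  calc ‖1 - t ^ 2‖ ^ 2 ≤ (1 / 3) ^ 2 := by gcongr
    _ = 1 / 9 := by norm_num

/-! ### §7 Assembly: `h ≡ (e'⁴ − u²)/2 (mod 9)`, hence `h ≠ 0` from `9 ∤ e'⁴ − u²` -/

/-- **The first-order REG3CERT kernel certificate.** Let `W/ℚ` be globally minimal with `a₁, a₂, c₄, c₆` (read in `ℚ₃`)
equal to the given integers, `3 ∤ c₆`; let `(x, y) = (a/e², b/e³)` with `e = 3e'`, `3 ∤ e'`, `3 ∤ b`, `gcd(a, e) = 1`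
(so `den x = e²`); and let `γ, ζ, ℓ, ω, κ, u` be integers with
`9 ∣ c₄ + γc₆`, `3 ∤ γ`, `81 ∣ ae + ζb`, `3⁵ ∣ 6ζ + 3a₁ζ² + 2(a₁²+a₂)ζ³ − 6ℓ`, `9 ∣ ω`, `81 ∣ ℓ² − ωγ`, `9 ∣ κ`,
`3⁵ ∣ ω² + 12ω − 24κ`, `9u = 2γκ`, `3 ∤ u`. If **`9 ∤ e'⁴ − u²`**, then for EVERY `q ∈ ℚ₃` with `‖q‖ < 1`,
`heightFourOneCoord W 3 q x y ≠ 0` — because `h ≡ log₃(9e'²) − log₃(C²σ²) ≡ (e'⁴ − 1)/2 − (u² − 1)/2 (mod 9)`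
(parts 1–2). This is the numerical content `HH` of every REG3CERT row with `v₃(e(Q)) = 1 = v₃(h(Q))`, decided by
`norm_num` on the row's integers. [cite: SteinWuthrich2013, §4.2] [cite: Iwasawa1972PadicL, §4.4] -/
theorem heightFourOneCoord_ne_zero_of_residueCert (W : WeierstrassCurve ℚ) [W.IsGloballyMinimal]
    {a₁ a₂ c4 c6 : ℤ} (ha1 : (W.baseChange ℚ_[3]).a₁ = a₁) (ha2 : (W.baseChange ℚ_[3]).a₂ = a₂)
    (hc4 : (W.baseChange ℚ_[3]).c₄ = c4) (hc6 : (W.baseChange ℚ_[3]).c₆ = c6) (h3c6 : ¬ (3 : ℤ) ∣ c6)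
    {a b : ℤ} {e' : ℕ} (h3e' : ¬ (3 : ℤ) ∣ e') (h3b : ¬ (3 : ℤ) ∣ b) (hcop : Nat.Coprime a.natAbs (3 * e'))
    {x y : ℚ} (hx : x = a / ((3 * e' : ℕ) : ℚ) ^ 2) (hy : y = b / ((3 * e' : ℕ) : ℚ) ^ 3)
    {γ ζ ℓ ω κ u : ℤ} (hγ : (9 : ℤ) ∣ c4 + γ * c6) (h3γ : ¬ (3 : ℤ) ∣ γ)
    (hζ : (81 : ℤ) ∣ a * (3 * e' : ℕ) + ζ * b)
    (hℓ : (243 : ℤ) ∣ 6 * ζ + 3 * a₁ * ζ ^ 2 + 2 * (a₁ ^ 2 + a₂) * ζ ^ 3 - 6 * ℓ)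
    (hω9 : (9 : ℤ) ∣ ω) (hω : (81 : ℤ) ∣ ℓ ^ 2 - ω * γ) (hκ9 : (9 : ℤ) ∣ κ)
    (hκ : (243 : ℤ) ∣ ω ^ 2 + 12 * ω - 24 * κ) (hu : 9 * u = 2 * γ * κ) (h3u : ¬ (3 : ℤ) ∣ u)
    (hcert : ¬ (9 : ℤ) ∣ (e' : ℤ) ^ 4 - u ^ 2) {q : ℚ_[3]} (hq : ‖q‖ < 1) :
    heightFourOneCoord W 3 q x y ≠ 0 := by
  have hq3 : ‖q‖ ≤ 1 / 3 := norm_le_third_of_norm_lt_one hq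
  have he'0 : e' ≠ 0 := by rintro rfl; exact h3e' (by simp)
  have he0 : (3 * e' : ℕ) ≠ 0 := by positivity
  have hb0 : b ≠ 0 := by rintro rfl; exact h3b (dvd_zero 3)
  have h3e : (3 : ℤ) ∣ ((3 * e' : ℕ) : ℤ) := ⟨e', by push_cast; ring⟩
  -- part 1: `w ≡ ω`, `‖w‖ ≤ 3⁻²`, `C² ≡ γ`
  obtain ⟨hw, -, hC⟩ := norm_logUnitParamSq_sub_intCast_le W ha1 ha2 hc4 hc6 h3c6 hb0 he0 h3e h3b hx hy hγ h3γ hζ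
    hℓ hω9 hω hq3
  set w := logUnitParamSq W 3 q x y with hwdef
  set C2 := uniformisationScaleSq W 3 q with hC2
  -- part 2: `c − 1 ≡ κ`, `σ² ≡ 2κ`, `C²σ² ≡ 9u`, the logarithm of `C²σ²`
  have hc1 := norm_coshOfSq_sub_one_sub_intCast_le hw hω9 hκ
  have hS := norm_tateSigmaSq_sub_intCast_le hq3 hc1 hκ9
  set S2 := tateSigmaSq q (coshOfSq w) with hS2
  have hY := norm_mul_sub_nine_mul_le hC h3γ hS hκ9 hu
  have hlogY := norm_padicLog_sub_le_of_norm_sub_le h3u hY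
  -- the logarithm of `den x = 9e'²`
  have hden : x.den = (3 * e') ^ 2 := by
    have hpos : (0 : ℤ) < ((3 * e' : ℕ) : ℤ) ^ 2 := by positivity
    have hcop2 : Nat.Coprime a.natAbs ((((3 * e' : ℕ) : ℤ) ^ 2).natAbs) := by
      rw [Int.natAbs_pow, Int.natAbs_natCast]; exact hcop.pow_right 2
    have h := Rat.den_div_eq_of_coprime hpos hcop2
    have hx' : x = ((a : ℤ) : ℚ) / ((((3 * e' : ℕ) : ℤ) ^ 2 : ℤ) : ℚ) := by rw [hx]; push_cast; ring
    rw [← hx'] at h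
    exact_mod_cast h
  have h3e2 : ¬ (3 : ℤ) ∣ ((e' : ℤ) ^ 2) := fun h => h3e' (Int.Prime.dvd_pow' (by norm_num) h)
  have hYd : ‖(((x.den : ℚ)) : ℚ_[3]) - 9 * (((e' : ℤ) ^ 2 : ℤ) : ℚ_[3])‖ ≤ 1 / 81 := by
    rw [hden]; push_cast; ring_nf; rw [norm_zero]; norm_num
  have hlogd := norm_padicLog_sub_le_of_norm_sub_le h3e2 hYd
  -- assembly
  intro h0
  rw [heightFourOneCoord] at h0
  have heq : padicLog 3 (((x.den : ℚ)) : ℚ_[3]) = padicLog 3 (C2 * S2) := sub_eq_zero.mp h0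
  rw [heq] at hlogd
  have hdiff : ‖(2 : ℚ_[3])⁻¹ * ((((e' : ℤ) ^ 2) ^ 2 - 1 : ℤ) : ℚ_[3]) -
      (2 : ℚ_[3])⁻¹ * (((u ^ 2 - 1 : ℤ)) : ℚ_[3])‖ ≤ 1 / 9 := by
    have : (2 : ℚ_[3])⁻¹ * ((((e' : ℤ) ^ 2) ^ 2 - 1 : ℤ) : ℚ_[3]) - (2 : ℚ_[3])⁻¹ * (((u ^ 2 - 1 : ℤ)) : ℚ_[3]) =
        (padicLog 3 (C2 * S2) - (2 : ℚ_[3])⁻¹ * (((u ^ 2 - 1 : ℤ)) : ℚ_[3])) -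
        (padicLog 3 (C2 * S2) - (2 : ℚ_[3])⁻¹ * ((((e' : ℤ) ^ 2) ^ 2 - 1 : ℤ) : ℚ_[3])) := by ring
    rw [this]; exact (norm_sub_le_max₁ _ _).trans (max_le hlogY hlogd)
  have hint : (2 : ℚ_[3])⁻¹ * ((((e' : ℤ) ^ 2) ^ 2 - 1 : ℤ) : ℚ_[3]) - (2 : ℚ_[3])⁻¹ * (((u ^ 2 - 1 : ℤ)) : ℚ_[3]) =
      (2 : ℚ_[3])⁻¹ * ((((e' : ℤ) ^ 4 - u ^ 2 : ℤ)) : ℚ_[3]) := by push_cast; ring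
  rw [hint, norm_mul, norm_inv_two', one_mul] at hdiff
  have h9 : ((3 : ℕ) : ℤ) ^ 2 ∣ (e' : ℤ) ^ 4 - u ^ 2 :=
    (Padic.norm_int_le_pow_iff_dvd (p := 3) _ 2).mp (hdiff.trans (by norm_num))
  exact hcert (by simpa using h9)

end Summit.BirchSwinnertonDyer.Rank1Residual.X11b.RegMult.KernelCert
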